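import Summits.AtomisticToContinuum.Crystallization.Theorems.FreeSplittingCertificatesStrictSplittingRuleP1FarF2
import Summits.AtomisticToContinuum.Crystallization.Theorems.FreeSplittingCertificatesStrictSplittingRuleP1TransferTable
import Summits.AtomisticToContinuum.Crystallization.Theorems.FreeSplittingCertificatesStrictSplittingRuleP1AssemblyGlue

/-!
# `StrictSplittingRule` (stmt-AtomisticToContinuum-12560): THE FAR HALF AT A SITE — far inequality F2 ∘ receipts transfer, in H12⋆'s vocabulary (P1 interpolant object, part 50)

Route `FreeSplittingCertificates`, crux r3 `StrictSplittingRule` (H12⋆ = `stub_coreJointCoercive`), unit b2b-freesplit-B gen 32.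
VALUE = terms (T2)∘(T3) of the kernel assembly map (HOME FAR-LEMMA-SPEC §23 (b)) composed into ONE statement per site `p` (either representative): for the far-ledger field
`v = p1Disp a h U b₀ A` re-based at `y_p`, the split weight `χ = fpChi R₁² R₂²`, any `κ ≥ 0`, on the `HcpFamilyMin` box,
`κ·∫χ²N_F2(ṽ_p) ≤ κ(2/5)a⁻⁴ · Σ'_q Σ_{d∈p1BondOffsets} p1RecTable(p1SplitDensity R₁ R₂)(p1Par q)(p−q) d · p1Str(q,q+d)² + κ·∫2χ⟪∇χ,Φ_F2(ṽ_p)⟫`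
(**`farHalf_F2_le`**: `farPencilF2_weighted_integral_le_p1Disp_translate` + `farReceipts_le_tsum_table` + `ratioBox_of_hcpFamilyMin`), and the same with the receipts written
in H12⋆'s stretches `⟪y_{q+d} − y_q, u_{q+d} − u_q⟫` when `A` is the matrix of a SKEW co-rotation `W` (**`farHalf_F2_le_skew`**, `p1Str_eq_inner_of_skew`) — i.e. the
continuum demand of site `p`'s far ledger is paid by the far diagonal table `M_far = −κ(t/a⁴)·p1RecTable` (whose antisymmetrised series is receipts − payments, part 39) plus the
flux term (= the re-centred cell form, `integral_fluxF2_p1Disp_translate_eq_tsum`, paid by the near ledger).  NOT a proof of H12⋆, NOT summit progress.  [folklore]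
-/

noncomputable section

open Set Function MeasureTheory
open scoped BigOperators

namespace Summit.AtomisticToContinuum.Crystallization.Theorems.StrictSplittingRuleBirth

open Literature.MathematicalPhysics.StatisticalMechanics
open Summit.AtomisticToContinuum.Crystallization.Theorems.PalmUnimodularRigidity.LayeredLawsSelectHcp

/-- **THE FAR HALF AT SITE `p`** (certificate F2, `t = 2/5`): on the `HcpFamilyMin` box, for any finitely supported `U`, any `(b₀, A)`, any `κ ≥ 0` and `0 < R₁ < R₂`,
`κ∫χ²N_F2(ṽ_p) ≤ κ·(2/5)/a⁴·Σ'_q Σ_d p1RecTable(…)(p1Par q)(p−q) d·p1Str(q,q+d)² + κ∫2χ⟪∇χ,Φ_F2(ṽ_p)⟫` with `ṽ_p(x) = p1Disp a h U b₀ A (y_p + x)`.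
NOT a proof of H12⋆, NOT summit progress. -/
theorem farHalf_F2_le {a h : ℝ} (ha : 0 < a) (hh : 0 < h) (hfam : HcpFamilyMin a h) (U : ℤ × ℤ × ℤ → (Fin 3 → ℝ))
    (hU : (support U).Finite) (b₀ : Fin 3 → ℝ) (A : Fin 3 → Fin 3 → ℝ) (p : ℤ × ℤ × ℤ) {R1 R2 : ℝ} (hR1 : 0 < R1) (hR12 : R1 < R2)
    {κ : ℝ} (hκ : 0 ≤ κ) :
    κ * ∫ x, fpChi (R1 ^ 2) (R2 ^ 2) x ^ 2 *
        fpNumI (5 / 2) (5 / 2) (5 / 4) (3 / 4) x (p1Disp a h U b₀ A ((fun k => hcpSite a h p k) + x))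
          (fpGrad (fun y => p1Disp a h U b₀ A ((fun k => hcpSite a h p k) + y)) x) ≤
      κ * (2 / 5) / a ^ 4 * (∑' q, ∑ d ∈ p1BondOffsets,
        p1RecTable a h (p1SplitDensity R1 R2) (p1Par q) (p - q) d * p1Str a h U b₀ A q (q + d) ^ 2) +
      κ * ∫ x, 2 * fpChi (R1 ^ 2) (R2 ^ 2) x *
        fpFlux4DotGrad (1 / 3) (4 / 3) (-(9 / 8)) (1 / 8) (fun y => p1Disp a h U b₀ A ((fun k => hcpSite a h p k) + y))
          (fpChi (R1 ^ 2) (R2 ^ 2)) x := by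
  obtain ⟨hlo, hhi⟩ := ratioBox_of_hcpFamilyMin ha hh hfam
  have h3 := farPencilF2_weighted_integral_le_p1Disp_translate ha hh U hU (fun k => hcpSite a h p k) b₀ A hR1 hR12
  have h2 := (farReceipts_le_tsum_table ha hlo hhi U hU b₀ A p hR1 hR12).2
  have ha4 : 0 < a ^ 4 := pow_pos ha 4
  set X := ∫ x, fpChi (R1 ^ 2) (R2 ^ 2) x ^ 2 * fpDen x (fpGrad (fun y => p1Disp a h U b₀ A ((fun k => hcpSite a h p k) + y)) x) with hX
  set Y := ∑' q, ∑ d ∈ p1BondOffsets, p1RecTable a h (p1SplitDensity R1 R2) (p1Par q) (p - q) d * p1Str a h U b₀ A q (q + d) ^ 2 with hY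
  have hXY : X ≤ Y / a ^ 4 := by
    rw [le_div_iff₀ ha4]
    linarith [h2]
  calc κ * ∫ x, fpChi (R1 ^ 2) (R2 ^ 2) x ^ 2 *
        fpNumI (5 / 2) (5 / 2) (5 / 4) (3 / 4) x (p1Disp a h U b₀ A ((fun k => hcpSite a h p k) + x))
          (fpGrad (fun y => p1Disp a h U b₀ A ((fun k => hcpSite a h p k) + y)) x)
      ≤ κ * (2 / 5 * X + ∫ x, 2 * fpChi (R1 ^ 2) (R2 ^ 2) x *
          fpFlux4DotGrad (1 / 3) (4 / 3) (-(9 / 8)) (1 / 8) (fun y => p1Disp a h U b₀ A ((fun k => hcpSite a h p k) + y))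
            (fpChi (R1 ^ 2) (R2 ^ 2)) x) := mul_le_mul_of_nonneg_left h3 hκ
    _ ≤ κ * (2 / 5 * (Y / a ^ 4) + ∫ x, 2 * fpChi (R1 ^ 2) (R2 ^ 2) x *
          fpFlux4DotGrad (1 / 3) (4 / 3) (-(9 / 8)) (1 / 8) (fun y => p1Disp a h U b₀ A ((fun k => hcpSite a h p k) + y))
            (fpChi (R1 ^ 2) (R2 ^ 2)) x) := by
        gcongr
    _ = _ := by ring

/-- **THE FAR HALF AT SITE `p` in H12⋆'s vocabulary**: for a finitely supported displacement `u : ℤ³ → ℝ³`, a SKEW co-rotation `W` acting by the matrix `A`, the receipts are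
the lattice stretches `⟪y_{q+d} − y_q, u_{q+d} − u_q⟫²` (the rotation drops out, `p1Str_eq_inner_of_skew`).  NOT a proof of H12⋆, NOT summit progress. -/
theorem farHalf_F2_le_skew {a h : ℝ} (ha : 0 < a) (hh : 0 < h) (hfam : HcpFamilyMin a h)
    (u : ℤ × ℤ × ℤ → EuclideanSpace ℝ (Fin 3)) (hu : (support u).Finite)
    (W : EuclideanSpace ℝ (Fin 3) →ₗ[ℝ] EuclideanSpace ℝ (Fin 3)) (hW : ∀ z : EuclideanSpace ℝ (Fin 3), inner ℝ (W z) z = 0)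
    (A : Fin 3 → Fin 3 → ℝ) (hA : ∀ (y : EuclideanSpace ℝ (Fin 3)) (k : Fin 3), W y k = y 0 * A 0 k + y 1 * A 1 k + y 2 * A 2 k)
    (b₀ : Fin 3 → ℝ) (p : ℤ × ℤ × ℤ) {R1 R2 : ℝ} (hR1 : 0 < R1) (hR12 : R1 < R2) {κ : ℝ} (hκ : 0 ≤ κ) :
    κ * ∫ x, fpChi (R1 ^ 2) (R2 ^ 2) x ^ 2 *
        fpNumI (5 / 2) (5 / 2) (5 / 4) (3 / 4) x (p1Disp a h (fun n k => u n k) b₀ A ((fun k => hcpSite a h p k) + x))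
          (fpGrad (fun y => p1Disp a h (fun n k => u n k) b₀ A ((fun k => hcpSite a h p k) + y)) x) ≤
      κ * (2 / 5) / a ^ 4 * (∑' q, ∑ d ∈ p1BondOffsets,
        p1RecTable a h (p1SplitDensity R1 R2) (p1Par q) (p - q) d *
          (inner ℝ (hcpSite a h (q + d) - hcpSite a h q) (u (q + d) - u q)) ^ 2) +
      κ * ∫ x, 2 * fpChi (R1 ^ 2) (R2 ^ 2) x *
        fpFlux4DotGrad (1 / 3) (4 / 3) (-(9 / 8)) (1 / 8) (fun y => p1Disp a h (fun n k => u n k) b₀ A ((fun k => hcpSite a h p k) + y))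
          (fpChi (R1 ^ 2) (R2 ^ 2)) x := by
  have hU : (support fun n => fun k => u n k).Finite := by
    refine hu.subset fun n hn => ?_
    simp only [mem_support, ne_eq] at hn ⊢
    intro h0
    apply hn
    funext k
    rw [h0]
    rfl
  have hmain := farHalf_F2_le ha hh hfam (fun n k => u n k) hU b₀ A p hR1 hR12 hκ
  simp only [p1Str_eq_inner_of_skew ha.ne' hh.ne' u W hW A hA] at hmain
  exact hmain

end Summit.AtomisticToContinuum.Crystallization.Theorems.StrictSplittingRuleBirth

end
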